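import Literature.AlgebraicGeometry.Resolution.AffineBlowupAlgebra
import Mathlib.RingTheory.MvPolynomial.Basic
import Mathlib.Algebra.MvPolynomial.CommRing
import Mathlib.RingTheory.Ideal.Quotient.Operations
import Mathlib.RingTheory.Localization.Away.Basic
import Summits.ResolutionOfSingularities.ResolutionOfSingularities.Theorems.FrobeniusLadderFInjectiveMacaulayficationStrictTransformChartN
import HarnessLib

/-!
# Strict-transform presentation of the blow-up charts of a hypersurface in `𝔸ⁿ` along a COORDINATE SUB-CENTRE `(x_j : j ∈ Λ)`
# (crux `FInjectiveMacaulayfication` stmt-ResolutionOfSingularities-15315, chain w45a; res-L1-w45a-lead-1 g9 — the shared brick for (L-f) V2, (L-g)/NEG-N (R19.21),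
# (O-3); generalizes res-L1-w45a-stub-2/3's `…StrictTransformChartN` (the point centre `Λ = everything`) verbatim, line by line)

[OURS · L1 W4.5a] Support file (`--supports stmt-ResolutionOfSingularities-15315 --as helper`); def-free, fact-free, UNCONDITIONAL; generic. AI-written (AI review is weaker than
expert review).

WHAT. `R = k[X₀,…,X_{n-1}]/(f)` (via a surjection `π` with kernel `(f)`), `x j = π (X j)`, a finite set `Λ` of variable indices, `i ∈ Λ`, the centre `I = (x_j : j ∈ Λ)`, `a = x i`.
The chart substitution `θ : X i ↦ X i, X j ↦ X j · X i (j ∈ Λ, j ≠ i), X j ↦ X j (j ∉ Λ)`, `c ↦ c`; if `θ f = X i ^ μ · g` with `(g)` prime and `X i ∉ (g)`, then the chart ring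
`(R[It])_{(a t)} = R[I/a]` of `Bl_I (Spec R)` IS `k[X]/(g)`, the class of `X i` going to `a/1`:
* §1 `exists_pow_mul_eq` (clearing denominators for the partial substitution), `comp_eq`, `map_eq_zero_of_transform`, `mem_span_of_map_eq_zero` (`ker ψ ⊆ (g)`),
  `map_mem_blowupAlgebra` / `exists_map_eq_of_mem_blowupAlgebra` (`ψ(k[X]) = R[I/a]`) — as in the point-centre file, with the variables outside `Λ` passing through unchanged;
* §2 ★ `exists_ringEquiv` (abstract `π`), ★★ `strictTransformChartSub` (the hypersurface form: `f g : MvPolynomial (Fin n) k`, `Λ : Finset (Fin n)`, `i ∈ Λ`,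
  `aeval (fun j => if j ∈ Λ ∧ j ≠ i then X j * X i else X j) f = X i ^ μ * g`, `(g)` prime, `X i ∉ (g)` (NO hypothesis on `f`) ⟹
  `k[X]/(g) ≃+* HomogeneousLocalization.Away (reesGrading (Ideal.span (x '' Λ))) (reesT (x i) _)` sending `X̄ i ↦ a/1`).
USE: with `Literature…AffineBlowupCartier`'s `affineBlowup.chartι` this gives the OPEN IMMERSION `Spec k[X]/(g) ⟶ Bl_{(x_j : j ∈ Λ)} Spec k[X]/(f)` that the loop certificates need
(rad-τ 2-cycle `L ⇄ M`: centres `(a,c,d,e)`, `(a,c,e)`; N-loop `U₀`: centre `(x,y,z)`; (O-3): centre `(c,d,e)`).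
[folklore; cite: StacksProject, Tag 0804; Tag 052Q] [cite: Kollar2007, §2.5]
-/

-- single-problem summit: the doubled namespace component is forced
set_option linter.dupNamespace false

noncomputable section

namespace Summit.ResolutionOfSingularities.ResolutionOfSingularities.Theorems.FInjectiveMacaulayfication.StrictTransformChartSub

open Literature.AlgebraicGeometry.Resolution MvPolynomial

section Substitution

variable {k : Type*} [CommRing k] {n : ℕ} {Λ : Finset (Fin n)} {i : Fin n}
  (θ : MvPolynomial (Fin n) k →+* MvPolynomial (Fin n) k)

/-- **Clearing denominators** for the partial chart substitution `θ` (`X j ↦ X j X i` on `Λ ∖ {i}`, identity elsewhere): every `h` satisfies `X i ^ N · h = θ H`. [folklore] -/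
theorem exists_pow_mul_eq (hθC : ∀ c : k, θ (C c) = C c) (hθi : θ (X i) = X i)
    (hθj : ∀ j : Fin n, j ∈ Λ → j ≠ i → θ (X j) = X j * X i) (hθo : ∀ j : Fin n, j ∉ Λ → θ (X j) = X j)
    (h : MvPolynomial (Fin n) k) : ∃ (N : ℕ) (H : MvPolynomial (Fin n) k), X i ^ N * h = θ H := by
  induction h using MvPolynomial.induction_on with
  | C c => exact ⟨0, C c, by rw [pow_zero, one_mul, hθC]⟩
  | add p q hp hq =>
    obtain ⟨N₁, H₁, h₁⟩ := hp
    obtain ⟨N₂, H₂, h₂⟩ := hq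
    refine ⟨N₁ + N₂, X i ^ N₂ * H₁ + X i ^ N₁ * H₂, ?_⟩
    rw [map_add, map_mul, map_mul, map_pow, map_pow, hθi, ← h₁, ← h₂]
    ring
  | mul_X p l hp =>
    obtain ⟨N, H, hH⟩ := hp
    by_cases hl : l ∈ Λ ∧ l ≠ i
    · refine ⟨N + 1, H * X l, ?_⟩
      rw [map_mul, hθj l hl.1 hl.2, ← hH]
      ring
    · have hθl : θ (X l) = X l := by
        by_cases hli : l = i
        · rw [hli, hθi]
        · exact hθo l (fun hmem => hl ⟨hmem, hli⟩)
      refine ⟨N, H * X l, ?_⟩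
      rw [map_mul, hθl, ← hH]
      ring

end Substitution

section Centre

variable {R : Type*} [CommRing R] {n : ℕ}

/-- `x i ∈ (x_j : j ∈ Λ)` for `i ∈ Λ` (the membership proof carried by `reesT` / `reesChartBase` below). -/
theorem mem_centre (x : Fin n → R) (Λ : Finset (Fin n)) {i : Fin n} (hi : i ∈ Λ) : x i ∈ Ideal.span (x '' (Λ : Set (Fin n))) :=
  Ideal.subset_span ⟨i, Finset.mem_coe.mpr hi, rfl⟩

end Centre

section Chart

variable {k : Type*} [CommRing k] {R : Type*} [CommRing R] {n : ℕ} {Λ : Finset (Fin n)}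
  (π : MvPolynomial (Fin n) k →+* R)
  (x : Fin n → R) {i : Fin n}
  (ψ : MvPolynomial (Fin n) k →+* Localization.Away (x i))

/-- **`ψ ∘ θ = (R → R[1/a]) ∘ π`** for `ψ : X i ↦ a`, `X j ↦ x j / a` (`j ∈ Λ ∖ {i}`), `X j ↦ x j` (`j ∉ Λ`), `c ↦ π c`. [folklore] -/
theorem comp_eq (hx : ∀ j, x j = π (X j))
    (hψC : ∀ c, ψ (C c) = algebraMap R (Localization.Away (x i)) (π (C c)))
    (hψi : ψ (X i) = algebraMap R (Localization.Away (x i)) (x i))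
    (hψj : ∀ j, j ∈ Λ → j ≠ i → ψ (X j) = algebraMap R (Localization.Away (x i)) (x j) * IsLocalization.Away.invSelf (x i))
    (hψo : ∀ j, j ∉ Λ → ψ (X j) = algebraMap R (Localization.Away (x i)) (x j))
    (θ : MvPolynomial (Fin n) k →+* MvPolynomial (Fin n) k) (hθC : ∀ c : k, θ (C c) = C c)
    (hθi : θ (X i) = X i) (hθj : ∀ j : Fin n, j ∈ Λ → j ≠ i → θ (X j) = X j * X i) (hθo : ∀ j : Fin n, j ∉ Λ → θ (X j) = X j) :
    ψ.comp θ = (algebraMap R (Localization.Away (x i))).comp π := by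
  refine MvPolynomial.ringHom_ext (fun c => ?_) (fun j => ?_)
  · rw [RingHom.comp_apply, hθC, hψC, RingHom.comp_apply]
  · rw [RingHom.comp_apply, RingHom.comp_apply, ← hx]
    by_cases hj : j = i
    · rw [hj, hθi, hψi]
    · by_cases hmem : j ∈ Λ
      · rw [hθj j hmem hj, map_mul, hψi, hψj j hmem hj, div_mul_algebraMap]
      · rw [hθo j hmem, hψo j hmem]

/-- **`ker ψ ⊆ (g)`** (clearing denominators, as in the point-centre file). [folklore] -/
theorem mem_span_of_map_eq_zero (hx : ∀ j, x j = π (X j))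
    (θ : MvPolynomial (Fin n) k →+* MvPolynomial (Fin n) k) (hθC : ∀ c : k, θ (C c) = C c)
    (hθi : θ (X i) = X i) (hθj : ∀ j : Fin n, j ∈ Λ → j ≠ i → θ (X j) = X j * X i) (hθo : ∀ j : Fin n, j ∉ Λ → θ (X j) = X j)
    (hcomp : ψ.comp θ = (algebraMap R (Localization.Away (x i))).comp π)
    {f g : MvPolynomial (Fin n) k} {μ : ℕ} (hθf : θ f = X i ^ μ * g)
    (hπ : ∀ s, π s = 0 → s ∈ Ideal.span {f}) (hg : (Ideal.span {g}).IsPrime)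
    (hXi : X i ∉ Ideal.span {g}) {h : MvPolynomial (Fin n) k} (hh : ψ h = 0) :
    h ∈ Ideal.span {g} := by
  obtain ⟨N, H, hH⟩ := exists_pow_mul_eq θ hθC hθi hθj hθo h
  have h1 : algebraMap R (Localization.Away (x i)) (π H) = 0 := by
    have h1 := RingHom.congr_fun hcomp H
    rw [RingHom.comp_apply, RingHom.comp_apply, ← hH, map_mul, hh, mul_zero] at h1
    exact h1.symm
  obtain ⟨⟨_, m, rfl⟩, hm⟩ :=
    (IsLocalization.map_eq_zero_iff (Submonoid.powers (x i)) (Localization.Away (x i)) _).mp h1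
  change x i ^ m * π H = 0 at hm
  have h2 : X i ^ m * H ∈ Ideal.span {f} := hπ _ (by rw [map_mul, map_pow, ← hx]; exact hm)
  obtain ⟨c, hc⟩ := Ideal.mem_span_singleton'.mp h2
  have h3 := congrArg θ hc
  rw [map_mul, map_mul, map_pow, hθi, hθf, ← hH] at h3
  have h4 : X i ^ (m + N) * h ∈ Ideal.span {g} := by
    rw [pow_add, mul_assoc, ← h3]
    exact Ideal.mul_mem_left _ _ (Ideal.mul_mem_left _ _ (Ideal.mem_span_singleton_self g))
  rcases hg.mem_or_mem h4 with h5 | h5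
  · exact absurd (hg.mem_of_pow_mem _ h5) hXi
  · exact h5

/-- **`ψ(k[X]) ⊆ R[I/a]`**, `I = (x_j : j ∈ Λ)`. [folklore] -/
theorem map_mem_blowupAlgebra
    (hψC : ∀ c, ψ (C c) = algebraMap R (Localization.Away (x i)) (π (C c)))
    (hψi : ψ (X i) = algebraMap R (Localization.Away (x i)) (x i))
    (hψj : ∀ j, j ∈ Λ → j ≠ i → ψ (X j) = algebraMap R (Localization.Away (x i)) (x j) * IsLocalization.Away.invSelf (x i))
    (hψo : ∀ j, j ∉ Λ → ψ (X j) = algebraMap R (Localization.Away (x i)) (x j))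
    (h : MvPolynomial (Fin n) k) : ψ h ∈ blowupAlgebra (Ideal.span (x '' (Λ : Set (Fin n)))) (x i) := by
  induction h using MvPolynomial.induction_on with
  | C c =>
    rw [hψC]
    exact Subalgebra.algebraMap_mem _ _
  | add p q hp hq =>
    rw [map_add]
    exact Subalgebra.add_mem _ hp hq
  | mul_X p l hp =>
    rw [map_mul]
    refine Subalgebra.mul_mem _ hp ?_
    by_cases hl : l = i
    · rw [hl, hψi]
      exact Subalgebra.algebraMap_mem _ _
    · by_cases hmem : l ∈ Λ
      · rw [hψj l hmem hl]
        exact div_mem_blowupAlgebra _ _ (Ideal.subset_span ⟨l, Finset.mem_coe.mpr hmem, rfl⟩)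
      · rw [hψo l hmem]
        exact Subalgebra.algebraMap_mem _ _

/-- **`R[I/a] ⊆ ψ(k[X])`**. [folklore] -/
theorem exists_map_eq_of_mem_blowupAlgebra
    (hψj : ∀ j, j ∈ Λ → j ≠ i → ψ (X j) = algebraMap R (Localization.Away (x i)) (x j) * IsLocalization.Away.invSelf (x i))
    (hι : ∀ r : R, ∃ s : MvPolynomial (Fin n) k, ψ s = algebraMap R (Localization.Away (x i)) r)
    {y : Localization.Away (x i)} (hy : y ∈ blowupAlgebra (Ideal.span (x '' (Λ : Set (Fin n)))) (x i)) :
    ∃ s : MvPolynomial (Fin n) k, ψ s = y := by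
  let T : Subalgebra R (Localization.Away (x i)) :=
    { carrier := Set.range ψ
      mul_mem' := by
        rintro _ _ ⟨y₁, rfl⟩ ⟨y₂, rfl⟩
        exact ⟨y₁ * y₂, map_mul _ _ _⟩
      one_mem' := ⟨1, map_one _⟩
      add_mem' := by
        rintro _ _ ⟨y₁, rfl⟩ ⟨y₂, rfl⟩
        exact ⟨y₁ + y₂, map_add _ _ _⟩
      zero_mem' := ⟨0, map_zero _⟩
      algebraMap_mem' := hι }
  have hgen : ∀ j, j ∈ Λ → algebraMap R _ (x j) * IsLocalization.Away.invSelf (x i) ∈ T := by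
    intro j hj
    by_cases hji : j = i
    · rw [hji, IsLocalization.Away.mul_invSelf]
      exact one_mem T
    · exact ⟨X j, hψj j hj hji⟩
  have hle : blowupAlgebra (Ideal.span (x '' (Λ : Set (Fin n)))) (x i) ≤ T := by
    change Algebra.adjoin R (blowupAlgebraGens (Ideal.span (x '' (Λ : Set (Fin n)))) (x i)) ≤ T
    refine Algebra.adjoin_le ?_
    rintro _ ⟨c, hc, rfl⟩
    change algebraMap R _ c * IsLocalization.Away.invSelf (x i) ∈ T
    induction hc using Submodule.span_induction with
    | mem c hc =>
      obtain ⟨j, hj, rfl⟩ := hc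
      exact hgen j (Finset.mem_coe.mp hj)
    | zero =>
      rw [map_zero, zero_mul]
      exact zero_mem T
    | add c₁ c₂ _ _ h₁ h₂ =>
      rw [map_add, add_mul]
      exact add_mem h₁ h₂
    | smul r c _ hc =>
      rw [smul_eq_mul, map_mul, mul_assoc]
      exact mul_mem (Subalgebra.algebraMap_mem T r) hc
  exact hle hy

end Chart

section Assembly

variable {k : Type*} [CommRing k] {R : Type*} [CommRing R] {n : ℕ}

/-- ★ **Strict-transform presentation of a blow-up chart along a coordinate sub-centre** (abstract form): `π : k[X] → R` surjective with kernel `(f)`, `x j = π (X j)`,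
`Λ` a finite set of indices with `i ∈ Λ`, `I = (x_j : j ∈ Λ)`, `θ` the partial chart substitution with `θ f = X i ^ μ · g`, `(g)` prime, `X i ∉ (g)`: the chart ring `R[I/x i]` of
`Bl_I(Spec R)` is `k[X]/(g)`, the class of `X i` going to `x i / 1`. [cite: StacksProject, Tag 0804] -/
theorem exists_ringEquiv (π : MvPolynomial (Fin n) k →+* R) (hπs : Function.Surjective π)
    (x : Fin n → R) (Λ : Finset (Fin n)) {i : Fin n} (hi : i ∈ Λ) (hx : ∀ j, x j = π (X j)) {f g : MvPolynomial (Fin n) k} {μ : ℕ}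
    (hπ : ∀ s, π s = 0 ↔ s ∈ Ideal.span {f}) (hg : (Ideal.span {g}).IsPrime)
    (hXi : X i ∉ Ideal.span {g}) (θ : MvPolynomial (Fin n) k →+* MvPolynomial (Fin n) k)
    (hθC : ∀ c : k, θ (C c) = C c) (hθi : θ (X i) = X i)
    (hθj : ∀ j : Fin n, j ∈ Λ → j ≠ i → θ (X j) = X j * X i) (hθo : ∀ j : Fin n, j ∉ Λ → θ (X j) = X j) (hθf : θ f = X i ^ μ * g) :
    ∃ e : (MvPolynomial (Fin n) k ⧸ Ideal.span {g}) ≃+*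
        HomogeneousLocalization.Away (reesGrading (Ideal.span (x '' (Λ : Set (Fin n)))))
          (reesT (x i) (mem_centre x Λ hi)),
      e (Ideal.Quotient.mk (Ideal.span {g}) (X i)) =
        reesChartBase (x i) (mem_centre x Λ hi) (x i) := by
  have ha : x i ∈ Ideal.span (x '' (Λ : Set (Fin n))) := mem_centre x Λ hi
  classical
  -- the substitution `ψ : X i ↦ a, X j ↦ x j / a (j ∈ Λ ∖ {i}), X j ↦ x j (j ∉ Λ), c ↦ π c`
  let ψ : MvPolynomial (Fin n) k →+* Localization.Away (x i) :=
    MvPolynomial.eval₂Hom ((algebraMap R (Localization.Away (x i))).comp (π.comp MvPolynomial.C))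
      fun j => if j = i then algebraMap R (Localization.Away (x i)) (x i)
        else if j ∈ Λ then algebraMap R (Localization.Away (x i)) (x j) * IsLocalization.Away.invSelf (x i)
        else algebraMap R (Localization.Away (x i)) (x j)
  have hψC : ∀ c, ψ (C c) = algebraMap R (Localization.Away (x i)) (π (C c)) := fun c =>
    MvPolynomial.eval₂Hom_C _ _ c
  have hψi : ψ (X i) = algebraMap R (Localization.Away (x i)) (x i) := by
    simp [ψ]
  have hψj : ∀ j, j ∈ Λ → j ≠ i → ψ (X j) =
      algebraMap R (Localization.Away (x i)) (x j) * IsLocalization.Away.invSelf (x i) := by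
    intro j hj hji
    simp [ψ, hji, hj]
  have hψo : ∀ j, j ∉ Λ → ψ (X j) = algebraMap R (Localization.Away (x i)) (x j) := by
    intro j hj
    have hji : j ≠ i := fun h => hj (h ▸ hi)
    simp [ψ, hji, hj]
  have hcomp := comp_eq π x ψ hx hψC hψi hψj hψo θ hθC hθi hθj hθo
  have hι : ∀ r : R, ∃ s, ψ s = algebraMap R (Localization.Away (x i)) r := by
    intro r
    obtain ⟨s, rfl⟩ := hπs r
    exact ⟨θ s, RingHom.congr_fun hcomp s⟩
  have hmem := map_mem_blowupAlgebra π x ψ hψC hψi hψj hψo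
  let ψ' : MvPolynomial (Fin n) k →+* blowupAlgebra (Ideal.span (x '' (Λ : Set (Fin n)))) (x i) :=
    ψ.codRestrict (blowupAlgebra (Ideal.span (x '' (Λ : Set (Fin n)))) (x i)).toSubring hmem
  have hsurj : Function.Surjective ψ' := fun z => by
    obtain ⟨s, hs⟩ := exists_map_eq_of_mem_blowupAlgebra x ψ hψj hι z.2
    exact ⟨s, Subtype.ext hs⟩
  have hker : RingHom.ker ψ' = Ideal.span {g} := by
    apply le_antisymm
    · intro h hh
      exact mem_span_of_map_eq_zero π x ψ hx θ hθC hθi hθj hθo hcomp hθf (fun s => (hπ s).mp) hg hXi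
        (congrArg Subtype.val (RingHom.mem_ker.mp hh))
    · rw [Ideal.span_le, Set.singleton_subset_iff, SetLike.mem_coe, RingHom.mem_ker]
      exact Subtype.ext (StrictTransformChartN.map_eq_zero_of_transform π x ψ hψi θ hcomp hθf
        ((hπ f).mpr (Ideal.mem_span_singleton_self f)))
  refine ⟨(Ideal.quotEquivOfEq hker.symm).trans
    ((RingHom.quotientKerEquivOfSurjective hsurj).trans (reesChartEquiv (x i) ha).symm), ?_⟩
  rw [RingEquiv.trans_apply, RingEquiv.trans_apply, Ideal.quotEquivOfEq_mk,
    RingHom.quotientKerEquivOfSurjective_apply_mk, RingEquiv.symm_apply_eq,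
    reesChartEquiv_reesChartBase]
  exact Subtype.ext hψi

end Assembly

/-- ★★ **STRICT-TRANSFORM CHART ALONG A COORDINATE SUB-CENTRE** (hypersurface form): for `R = k[X]/(f)` (`f` ARBITRARY — no primality of `f` is needed), `Λ ∋ i` a set of variable indices, the substitution
`θ : X j ↦ X j · X i (j ∈ Λ, j ≠ i), X j ↦ X j (otherwise)` with `θ f = X i ^ μ · g`, `(g)` prime, `X i ∉ (g)`: the chart ring `(R[It])_{(x̄ i · t)}` of `Bl_I (Spec R)`,
`I = (x̄_j : j ∈ Λ)`, is `k[X]/(g)`, the class of `X i` being `x̄ i / 1`. [cite: StacksProject, Tag 0804] -/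
theorem strictTransformChartSub (k : Type) [Field k] (n : ℕ) (f g : MvPolynomial (Fin n) k) (Λ : Finset (Fin n)) (i : Fin n) (hi : i ∈ Λ) (μ : ℕ)
    (hgprime : (Ideal.span {g}).IsPrime) (hXi : MvPolynomial.X i ∉ Ideal.span {g})
    (hθf : MvPolynomial.aeval (fun j : Fin n => if j ∈ Λ ∧ j ≠ i then MvPolynomial.X j * MvPolynomial.X i else (MvPolynomial.X j : MvPolynomial (Fin n) k)) f =
      MvPolynomial.X i ^ μ * g)
    (x : Fin n → MvPolynomial (Fin n) k ⧸ Ideal.span {f}) (hx : x = fun j : Fin n => Ideal.Quotient.mk (Ideal.span {f}) (MvPolynomial.X j)) :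
    ∃ e : (MvPolynomial (Fin n) k ⧸ Ideal.span {g}) ≃+*
        HomogeneousLocalization.Away (reesGrading (Ideal.span (x '' (Λ : Set (Fin n)))))
          (reesT (x i) (mem_centre x Λ hi)),
      e (Ideal.Quotient.mk (Ideal.span {g}) (MvPolynomial.X i)) =
        reesChartBase (x i) (mem_centre x Λ hi) (x i) := by
  classical
  refine exists_ringEquiv (Ideal.Quotient.mk (Ideal.span {f})) Ideal.Quotient.mk_surjective x Λ hi
    (fun j => congrFun hx j) (fun s => Ideal.Quotient.eq_zero_iff_mem) hgprime hXi
    (MvPolynomial.aeval fun j : Fin n =>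
      if j ∈ Λ ∧ j ≠ i then MvPolynomial.X j * MvPolynomial.X i else (MvPolynomial.X j : MvPolynomial (Fin n) k)).toRingHom
    (fun c => MvPolynomial.algHom_C _ c) ?_ ?_ ?_ hθf
  · exact (MvPolynomial.aeval_X _ i).trans (if_neg (fun h => h.2 rfl))
  · intro j hj hji
    exact (MvPolynomial.aeval_X _ j).trans (if_pos ⟨hj, hji⟩)
  · intro j hj
    exact (MvPolynomial.aeval_X _ j).trans (if_neg (fun h => hj h.1))

end Summit.ResolutionOfSingularities.ResolutionOfSingularities.Theorems.FInjectiveMacaulayfication.StrictTransformChartSub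

end
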